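import Summits.SmoothPoincare4.SmoothPoincare4.Theses.CongruenceShadows
import Summits.SmoothPoincare4.SmoothPoincare4.Theses.GroupTrisection
import Literature.Topology.FourManifolds.TrisectionFunctorSPC4Proofs
import Literature.Topology.FourManifolds.TrisectionsProofs
import Literature.Topology.FourManifolds.SPC4Handles
import Literature.Topology.FourManifolds.SPC4HandlesImpliesCerf
import Literature.Topology.FourManifolds.CerfGammaFourProofs
import Literature.Topology.FourManifolds.SchoenfliesSphereThree
import Literature.Topology.FourManifolds.SmaleDiffDisc

/-!
# Line `lp-by-sphere-system-surgery` — skeleton for crux `AgkCor6Sufficiency` (stmt-SmoothPoincare4-10894)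

Crux (route `CongruenceShadows`, shared with `GroupTrisection`):
`AgkCor6Sufficiency := X → SmoothPoincare4`, `X` = AGK's Cor. 6 condition.  In the tree the crux
is exactly the two Abrams–Gay–Kirby leaves **(b′)** `diffeomorph_of_iso_groupGKTrisectionOf.{0}`
(rigidity) and **(c′)** `exists_stabilized_gkTrisection.{0}` (stabilisation)
(`spc4_of_forall_isStablyTrivial_of_three_leaves` with the PROVED GK Thm 4
`exists_isBalancedGKTrisection_holds`; `cruxBody_of_two_leaves` below, standard axioms).

The line (idea card `Ideas/lp-by-sphere-system-surgery.md`, Meier–Scott arXiv:2501.10524 §4 with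
`G = 1`): prove (b′) through

* `FillingUniqueness` — Meier–Scott Thm 4.1(2) for the trivial group, in Prop 4.8 form (2): every
  diffeomorphism between the boundaries of two compact connected orientable `4`-dimensional
  `1`-handlebodies extends to a diffeomorphism of the handlebodies (sphere-system surgery L4.6,
  ball systems L4.7, handles of index 3 and 4 determined by their attaching spheres L4.3; inputs Alexander,
  `Γ₃ = 0` — PROVED in tree as `extendsOverBall_two` —, Cerf `Γ₄ = 0`).  It contains the tree's
  Laudenbach–Poénaru fact `exists_diffeomorph_comp_incl_eq` (`lp_of_fillingUniqueness`, proved)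
  WITHOUT Laudenbach's 1973 sphere-isotopy theorem (the tree's stalled leaf THMAᴹ);
* `HandlebodyExtension` — a kernel-preserving diffeomorphism of handlebody boundaries extends
  (Griffiths 1964; disc lemma + Alexander + `Γ₃`);
* `DehnNielsenBaerCentral` — based, smooth, two-surface Dehn–Nielsen–Baer on central surfaces;
* `GeometricRigidity` — the 4-d assembly: spine neighbourhood model from the corner charts, the
  three sector complements are `1`-handlebody fillings of identified boundaries, three
  applications of `FillingUniqueness`, gluing;

and the marking bookkeeping `GeometricRigidity → DehnNielsenBaerCentral → (b′)` is PROVED here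
(`rigidity_of_geometricRigidity_of_dnb`).  (c′) is the tree's own named fact, in flight in the
`TrisectionStabilization*` files; it is registered as the delegated stub `stub_stabilization`.

Registered stubs (7): `stub_gammaFour`, `stub_alexander`, `stub_fillingUniqueness`,
`stub_handlebodyExtension`, `stub_dehnNielsenBaer`, `stub_geometricRigidity`,
`stub_stabilization`; sorry-free composition `AgkCor6Sufficiency_of_stubStatements` (stub
statements → crux body) and the by-name skeleton theorems `AgkCor6Sufficiency_of` /
`AgkCor6Sufficiency_of'` (crux of route CongruenceShadows / GroupTrisection from the stubs).

Disproof.lean (cdisprove cycle 1) honoured: no `_false_without_` theorem exists beyond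
`AgkCor6SufficiencyWithoutHyp = SmoothPoincare4`; the line USES the hypothesis `X` (`hst`) in
`AgkCor6Sufficiency_of` through `spc4_of_forall_isStablyTrivial_of_three_leaves`; no stub mentions
`X`, so the landed Negative lemmas (`isStablyTrivial_tight`, `not_forall_isGroupTrisection_punit_isStablyTrivial`,
`not_forall_isGroupTrisection_isStablyTrivial`, `agkCondition_downward`) refute no stub instance.
Necessity (ideator 2 notes): LP-depth is necessary — indeed `stub_gammaFour` is implied by
`FillingUniqueness` (`gammaFour_of_fillingUniqueness`, proved), and DNB is the one new 2-d leaf.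
-/

set_option linter.dupNamespace false

noncomputable section

open Set Function ContinuousMap
open scoped Manifold ContDiff Topology

namespace Summit.SmoothPoincare4.SmoothPoincare4.Cruxes.AgkCor6Sufficiency.LpBySphereSystemSurgery

open Literature.Topology.FourManifolds
open Summit.SmoothPoincare4.SmoothPoincare4.Theses.CongruenceShadows (AgkCor6Sufficiency)

/-! ## 0. The crux is (b′) + (c′) (tree assembly, GK Thm 4 discharged) -/

/-- The BODY of the crux (both route decls `CongruenceShadows.AgkCor6Sufficiency` and
`GroupTrisection.AgkCor6Sufficiency` unfold to it verbatim) from the two AGK leaves (b′), (c′) alone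
(W.lean / AxCheck `twoLeaves`).  Stated on the body so that exactly one theorem below concludes each
route decl by name. -/
theorem cruxBody_of_two_leaves (hb : diffeomorph_of_iso_groupGKTrisectionOf.{0})
    (hc : exists_stabilized_gkTrisection.{0}) :
    (∀ (k : ℕ) (K : TrisectionKernels (3 * k)),
        IsGroupTrisection (3 * k) k (PUnit : Type) K → K.IsStablyTrivial) →
      ∀ (M : Type) [TopologicalSpace M] [T2Space M] [SecondCountableTopology M],
        ContinuousMap.HomotopyEquiv.NonemptyDiffeomorphSphere M 4 :=
  fun hst M _ _ _ =>
    spc4_of_forall_isStablyTrivial_of_three_leaves exists_isBalancedGKTrisection_holds hb hc hst M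

/-! ## 1. The statements of the line -/

/-- **Filling uniqueness** (Meier–Scott 2025, Thm 4.1(2) with `G = 1`, in the form Prop 4.8(2)):
for compact connected orientable smooth `4`-dimensional `1`-handlebodies `V, V'` (handles of index
`≤ 1`), every diffeomorphism `ψ : ∂V ≅ ∂V'` of the boundary `3`-manifolds extends to a
diffeomorphism `Ψ : V ≅ V'` (`Ψ ∘ incl = incl' ∘ ψ`).  (`∂V ≅ ∂V'` forces equal numbers of
`1`-handles by `π₁`; `V ≅ V'` is the tree's proved UNIQ₄; the content is the rel-boundary
uniqueness of `1`-handlebody fillings, Meier–Scott's Laudenbach-free proof: L4.5–L4.7, L4.3 with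
`Γ₃ = 0` (`extendsOverBall_two`, proved) and Cerf's `Γ₄ = 0`.) -/
def FillingUniqueness : Prop :=
  ∀ (V V' : Type) [TopologicalSpace V] [T2Space V] [SecondCountableTopology V] [CompactSpace V]
    [ConnectedSpace V] [ChartedSpace (EuclideanHalfSpace 4) V] [IsManifold (𝓡∂ 4) ∞ V]
    [TopologicalSpace V'] [T2Space V'] [SecondCountableTopology V'] [CompactSpace V']
    [ConnectedSpace V'] [ChartedSpace (EuclideanHalfSpace 4) V'] [IsManifold (𝓡∂ 4) ∞ V']
    (_ : IsHandlebodyOfIndexLE 3 1 V) (_ : IsHandlebodyOfIndexLE 3 1 V')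
    (_ : IsOrientable (𝓡∂ 4) V) (_ : IsOrientable (𝓡∂ 4) V')
    (b : BoundaryData (𝓡∂ 4) V (𝓡 3)) (b' : BoundaryData (𝓡∂ 4) V' (𝓡 3))
    (ψ : b.carrier ≃ₘ⟮𝓡 3, 𝓡 3⟯ b'.carrier),
    ∃ Ψ : V ≃ₘ⟮𝓡∂ 4, 𝓡∂ 4⟯ V', ⇑Ψ ∘ b.incl = b'.incl ∘ ⇑ψ

/-- **Handlebody extension** (Griffiths 1964; Zieschang; Johannson): a diffeomorphism between the
boundary surfaces of two compact connected orientable `3`-dimensional handlebodies of genus `g`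
(one `0`-handle, `g` `1`-handles) that carries the kernel of `π₁(∂H) → π₁(H)` onto the kernel of
`π₁(∂H') → π₁(H')` extends to a diffeomorphism `H ≅ H'`.  (Meridian curves go to curves bounding
discs — handlebody disc lemma —, cut to `3`-balls — Alexander —, extend over the balls —
`Γ₃ = 0`, proved.) -/
def HandlebodyExtension : Prop :=
  ∀ (g : ℕ) (H H' : Type) [TopologicalSpace H] [T2Space H] [SecondCountableTopology H]
    [CompactSpace H] [ConnectedSpace H] [ChartedSpace (EuclideanHalfSpace 3) H]
    [IsManifold (𝓡∂ 3) ∞ H]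
    [TopologicalSpace H'] [T2Space H'] [SecondCountableTopology H'] [CompactSpace H']
    [ConnectedSpace H'] [ChartedSpace (EuclideanHalfSpace 3) H'] [IsManifold (𝓡∂ 3) ∞ H']
    (_ : HasHandleDecomposition 2 H (handleCount 1 g)) (_ : HasHandleDecomposition 2 H' (handleCount 1 g))
    (_ : IsOrientable (𝓡∂ 3) H) (_ : IsOrientable (𝓡∂ 3) H')
    (b : BoundaryData (𝓡∂ 3) H (𝓡 2)) (b' : BoundaryData (𝓡∂ 3) H' (𝓡 2))
    (ψ : b.carrier ≃ₘ⟮𝓡 2, 𝓡 2⟯ b'.carrier) (z₀ : b.carrier),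
    ((FundamentalGroup.map (⟨b.incl, b.continuous_incl⟩ : C(b.carrier, H)) z₀).ker).map
        (FundamentalGroup.map (⟨ψ, ψ.continuous⟩ : C(b.carrier, b'.carrier)) z₀) =
      (FundamentalGroup.map (⟨b'.incl, b'.continuous_incl⟩ : C(b'.carrier, H')) (ψ z₀)).ker →
    ∃ Ψ : H ≃ₘ⟮𝓡∂ 3, 𝓡∂ 3⟯ H', ⇑Ψ ∘ b.incl = b'.incl ∘ ⇑ψ

section Central

variable {X : Type} [TopologicalSpace X] [ChartedSpace (EuclideanSpace ℝ (Fin 4)) X]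
  {X' : Type} [TopologicalSpace X'] [ChartedSpace (EuclideanSpace ℝ (Fin 4)) X']

/-- A map `ψ : F → F'` between the central surfaces of two trisections is **ambiently smooth**:
near `F` it is the restriction of a `C^∞` map `X → X'` (Milnor's definition of smooth maps on
subsets; for the closed submanifold `F` this is smoothness of `ψ : F → X'`). -/
def AmbientSmooth (S : Fin 3 → Set X) (S' : Fin 3 → Set X')
    (ψ : centralSurface S → centralSurface S') : Prop :=
  ∃ (U : Set X) (Ψ : X → X'), IsOpen U ∧ (⋂ l, S l) ⊆ U ∧ ContMDiffOn (𝓡 4) (𝓡 4) ∞ Ψ U ∧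
    ∀ x : centralSurface S, Ψ x = (ψ x : X')

end Central

/-- **Dehn–Nielsen–Baer on central surfaces** (based, smooth, possibly orientation-reversing,
two-surface form; Nielsen 1927, Baer 1928, Epstein 1966; Zieschang–Vogt–Coldewey Thm 5.6.2;
Farb–Margalit Thm 8.1 / 8.8): for balanced Gay–Kirby trisections of two closed connected oriented
smooth `4`-manifolds with the same `(g, k)`, every isomorphism `θ : π₁(F, x₀) ≅ π₁(F', x₀')`
between the fundamental groups of the central surfaces (closed orientable genus-`g` surfaces,
`F = h(∂H)` by clause (iii)) is induced by a based homeomorphism `ψ : F ≅ F'`, smooth with smooth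
inverse in the ambient sense. -/
def DehnNielsenBaerCentral : Prop :=
  ∀ (X : Type) [TopologicalSpace X] [T2Space X] [SecondCountableTopology X]
    [ChartedSpace (EuclideanSpace ℝ (Fin 4)) X] [IsManifold (𝓡 4) ∞ X] [CompactSpace X]
    [ConnectedSpace X] (_ : SmoothOrientation (𝓡 4) X)
    (X' : Type) [TopologicalSpace X'] [T2Space X'] [SecondCountableTopology X']
    [ChartedSpace (EuclideanSpace ℝ (Fin 4)) X'] [IsManifold (𝓡 4) ∞ X'] [CompactSpace X']
    [ConnectedSpace X'] (_ : SmoothOrientation (𝓡 4) X')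
    (g k : ℕ) (S : Fin 3 → Set X) (S' : Fin 3 → Set X')
    (_ : IsBalancedGKTrisection X g k S) (_ : IsBalancedGKTrisection X' g k S')
    (x₀ : centralSurface S) (x₀' : centralSurface S')
    (_ : SurfaceGroup g ≃* FundamentalGroup (centralSurface S) x₀)
    (θ : FundamentalGroup (centralSurface S) x₀ ≃* FundamentalGroup (centralSurface S') x₀'),
    ∃ (ψ : centralSurface S ≃ₜ centralSurface S') (hψ : ψ x₀ = x₀'),
      AmbientSmooth S S' ψ ∧ AmbientSmooth S' S ψ.symm ∧
      ∀ γ, FundamentalGroup.mapOfEq (⟨ψ, ψ.continuous⟩ : C(centralSurface S, centralSurface S')) hψ γ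
        = θ γ

/-- **Geometric rigidity** (the group-theory-free half of (b′); Abrams–Gay–Kirby Thm 5 proof,
pp. 1541–1542, with Laudenbach–Poénaru replaced by `FillingUniqueness`): two closed connected
oriented smooth `4`-manifolds with balanced `(g, k)` Gay–Kirby trisections whose central surfaces
are related by a based, ambiently smooth homeomorphism `ψ` carrying each handlebody kernel
`ker (π₁ F → π₁ Hᵢ)` onto the corresponding one are diffeomorphic.  (Extend `ψ` over the three
handlebodies — `HandlebodyExtension` —, then over a regular neighbourhood of the spine
`H₀ ∪ H₁ ∪ H₂` using the corner charts / bicollars of `IsGKTrisection`; the three complements are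
`1`-handlebody fillings of identified boundaries, matched by `FillingUniqueness`; glue.) -/
def GeometricRigidity : Prop :=
  ∀ (X : Type) [TopologicalSpace X] [T2Space X] [SecondCountableTopology X]
    [ChartedSpace (EuclideanSpace ℝ (Fin 4)) X] [IsManifold (𝓡 4) ∞ X] [CompactSpace X]
    [ConnectedSpace X] (_ : SmoothOrientation (𝓡 4) X)
    (X' : Type) [TopologicalSpace X'] [T2Space X'] [SecondCountableTopology X']
    [ChartedSpace (EuclideanSpace ℝ (Fin 4)) X'] [IsManifold (𝓡 4) ∞ X'] [CompactSpace X']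
    [ConnectedSpace X'] (_ : SmoothOrientation (𝓡 4) X')
    (g k : ℕ) (S : Fin 3 → Set X) (S' : Fin 3 → Set X')
    (_ : IsBalancedGKTrisection X g k S) (_ : IsBalancedGKTrisection X' g k S')
    (x₀ : centralSurface S) (x₀' : centralSurface S')
    (ψ : centralSurface S ≃ₜ centralSurface S') (hψ : ψ x₀ = x₀'),
    AmbientSmooth S S' ψ → AmbientSmooth S' S ψ.symm →
    (∀ i : Fin 3, ((FundamentalGroup.map (centralInclusion S i) x₀).ker).map
        (FundamentalGroup.mapOfEq (⟨ψ, ψ.continuous⟩ : C(centralSurface S, centralSurface S')) hψ)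
        = (FundamentalGroup.map (centralInclusion S' i) x₀').ker) →
      Nonempty (X ≃ₘ⟮𝓡 4, 𝓡 4⟯ X')

/-! ## 2. Registered stubs -/

/-- **stub 1 — Cerf's `Γ₄ = 0`, extension form** (tree named fact, seat `CerfGammaFour*`; reduced
in tree to `cerf_pi0DiffDisc_relBoundary_three`).  NECESSARY for the line:
`gammaFour_of_fillingUniqueness`. -/
theorem stub_gammaFour : cerf_diffeomorph_sphere_three_extends_ball := by
  sorry

/-- **stub 2 — Alexander's theorem in `S³`** (tree named fact `SphereEmbedding.schoenflies_exists_ball`,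
seat `SchoenfliesSphereThree*`; reduced in tree to the one-sided `ℝ³` form,
`schoenflies_exists_ball_of_euclidean`). -/
theorem stub_alexander : SphereEmbedding.schoenflies_exists_ball := by
  sorry

/-- **stub 3 — the lever: Meier–Scott sphere-system surgery** (arXiv:2501.10524, Thm 4.1(2) with
`G = 1`, Lemmas 4.3, 4.5, 4.6, 4.7, Prop 4.8; Remark 4.2).  From `Γ₄ = 0` and Alexander (and the
proved `Γ₃ = 0` `extendsOverBall_two`, UNIQ₄
`nonempty_diffeomorph_of_hasHandleDecomposition_handleCount_one_holds`, `π₁ (∂V) ≅ F_k`). -/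
theorem stub_fillingUniqueness :
    cerf_diffeomorph_sphere_three_extends_ball → SphereEmbedding.schoenflies_exists_ball →
      FillingUniqueness := by
  sorry

/-- **stub 4 — handlebody extension** from Alexander (and the proved `Γ₃ = 0`). -/
theorem stub_handlebodyExtension :
    SphereEmbedding.schoenflies_exists_ball → HandlebodyExtension := by
  sorry

/-- **stub 5 — Dehn–Nielsen–Baer**, based smooth two-surface form on central surfaces. -/
theorem stub_dehnNielsenBaer : DehnNielsenBaerCentral := by
  sorry

/-- **stub 6 — geometric rigidity** from filling uniqueness and handlebody extension (corner
model of the spine neighbourhood, sector complements as `1`-handlebody fillings, gluing). -/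
theorem stub_geometricRigidity :
    FillingUniqueness → HandlebodyExtension → GeometricRigidity := by
  sorry

/-- **stub 7 — (c′) stabilisation compatibility** (tree named fact, AGK Thm 5 / GK Lemma 10; in
flight: `TrisectionStabilization*`, `TrisectionsStabilization*`, `GroupTrisectionsConnectSum`). -/
theorem stub_stabilization : exists_stabilized_gkTrisection.{0} := by
  sorry

/-! ## 3. Proved glue -/

/-- Prop 4.8 (2) ⇒ (1): filling uniqueness contains the tree's Laudenbach–Poénaru fact (so the
stub also discharges the LP seat `exists_diffeomorph_comp_incl_eq`, universe `0`). -/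
theorem lp_of_fillingUniqueness (h : FillingUniqueness) : exists_diffeomorph_comp_incl_eq.{0} :=
  fun V _ _ _ _ _ _ _ hV ho b φ => h V V hV hV ho ho b b φ

/-- The line cannot avoid Cerf: filling uniqueness already implies `Γ₄ = 0`
(`cerf_diffeomorph_sphere_three_extends_ball_of_exists_diffeomorph_comp_incl_eq`). -/
theorem gammaFour_of_fillingUniqueness (h : FillingUniqueness) :
    cerf_diffeomorph_sphere_three_extends_ball :=
  cerf_diffeomorph_sphere_three_extends_ball_of_exists_diffeomorph_comp_incl_eq
    (lp_of_fillingUniqueness h)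

/-- `Γ₃ = 0` is a theorem of the tree (Smale 1959 / Cerf, App. §5, Cor. 3): no stub needed. -/
theorem gammaThree_proved (φ : (Metric.sphere (0 : EuclideanSpace ℝ (Fin 3)) 1) ≃ₘ⟮𝓡 2, 𝓡 2⟯
    (Metric.sphere (0 : EuclideanSpace ℝ (Fin 3)) 1)) : ExtendsOverBall 2 φ :=
  extendsOverBall_two φ

section Bookkeeping

variable {A B : Type*} [Group A] [Group B]

/-- `comap` along a group isomorphism is `map` along its inverse. -/
theorem comap_mulEquiv_eq_map_symm (e : A ≃* B) (K : Subgroup B) :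
    K.comap e.toMonoidHom = K.map e.symm.toMonoidHom := by
  ext x
  simp only [Subgroup.mem_comap, MulEquiv.coe_toMonoidHom, Subgroup.mem_map]
  constructor
  · intro hx
    exact ⟨e x, hx, by simp⟩
  · rintro ⟨y, hy, rfl⟩
    simpa using hy

/-- `map` along a group isomorphism followed by `map` along its inverse is the identity. -/
theorem map_map_symm (e : A ≃* B) (K : Subgroup B) :
    (K.map e.symm.toMonoidHom).map e.toMonoidHom = K := by
  rw [Subgroup.map_map]
  have : e.toMonoidHom.comp e.symm.toMonoidHom = MonoidHom.id B := MonoidHom.ext fun x => by simp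
  rw [this, Subgroup.map_id]

end Bookkeeping

/-- **(b′) from geometric rigidity and Dehn–Nielsen–Baer** — the marking bookkeeping, proved:
an `Iso` of kernel triples through markings `μ, μ'` is an isomorphism
`θ = μ' ∘ α ∘ μ⁻¹ : π₁(F, x₀) ≅ π₁(F', x₀')` carrying each handlebody kernel onto the corresponding
one; DNB realises `θ` by a based ambiently-smooth homeomorphism, and geometric rigidity concludes. -/
theorem rigidity_of_geometricRigidity_of_dnb (hgeo : GeometricRigidity)
    (hdnb : DehnNielsenBaerCentral) : diffeomorph_of_iso_groupGKTrisectionOf.{0} := by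
  intro X _ _ _ _ _ _ _ o X' _ _ _ _ _ _ _ o' g k S S' h h' x₀ x₀' μ μ' hiso
  obtain ⟨α, hα⟩ := hiso
  -- the induced isomorphism of surface fundamental groups
  let θ : FundamentalGroup (centralSurface S) x₀ ≃* FundamentalGroup (centralSurface S') x₀' :=
    μ.symm.trans (α.trans μ')
  obtain ⟨ψ, hψ, hs, hs', hind⟩ := hdnb X o X' o' g k S S' h h' x₀ x₀' μ θ
  refine hgeo X o X' o' g k S S' h h' x₀ x₀' ψ hψ hs hs' fun i => ?_
  -- `ψ_* = θ` as homomorphisms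
  have hψθ : (FundamentalGroup.mapOfEq (⟨ψ, ψ.continuous⟩ : C(centralSurface S, centralSurface S')) hψ)
      = θ.toMonoidHom := MonoidHom.ext fun γ => hind γ
  rw [hψθ]
  -- kernel bookkeeping: `K i = (ker ιᵢ).comap μ`, `(K i).map α = K' i = (ker ι'ᵢ).comap μ'`
  have hKi : (FundamentalGroup.map (centralInclusion S i) x₀).ker
      = (groupGKTrisectionOf h x₀ μ i).map μ.toMonoidHom := by
    show _ = (((FundamentalGroup.map (centralInclusion S i) x₀).ker).comap μ.toMonoidHom).map μ.toMonoidHom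
    rw [comap_mulEquiv_eq_map_symm, map_map_symm]
  have hcomp : θ.toMonoidHom.comp μ.toMonoidHom = μ'.toMonoidHom.comp α.toMonoidHom :=
    MonoidHom.ext fun x => by simp [θ]
  calc ((FundamentalGroup.map (centralInclusion S i) x₀).ker).map θ.toMonoidHom
      = ((groupGKTrisectionOf h x₀ μ i).map μ.toMonoidHom).map θ.toMonoidHom := by rw [hKi]
    _ = (groupGKTrisectionOf h x₀ μ i).map (θ.toMonoidHom.comp μ.toMonoidHom) := by
        rw [Subgroup.map_map]
    _ = (groupGKTrisectionOf h x₀ μ i).map (μ'.toMonoidHom.comp α.toMonoidHom) := by rw [hcomp]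
    _ = ((groupGKTrisectionOf h x₀ μ i).map α.toMonoidHom).map μ'.toMonoidHom := by
        rw [Subgroup.map_map]
    _ = (groupGKTrisectionOf h' x₀' μ' i).map μ'.toMonoidHom := by rw [hα i]
    _ = (FundamentalGroup.map (centralInclusion S' i) x₀').ker := by
        show ((((FundamentalGroup.map (centralInclusion S' i) x₀').ker).comap μ'.toMonoidHom).map
          μ'.toMonoidHom) = _
        rw [comap_mulEquiv_eq_map_symm, map_map_symm]

/-! ## 4. The composition -/

/-- **The crux (its body) from the seven stub STATEMENTS** — the kernel-checked, sorry-free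
composition.  Hypotheses, in order, are exactly the statements of `stub_gammaFour`,
`stub_alexander`, `stub_fillingUniqueness`, `stub_handlebodyExtension`, `stub_dehnNielsenBaer`,
`stub_geometricRigidity`, `stub_stabilization`; the conclusion is the common BODY of the two route
decls `CongruenceShadows.AgkCor6Sufficiency` / `GroupTrisection.AgkCor6Sufficiency` (so that the
by-name theorems below are the only ones concluding the route decls, as `#h21_check_skeleton`
requires: a by-name skeleton theorem may take no hypotheses other than registered obligations). -/
theorem AgkCor6Sufficiency_of_stubStatements :
    cerf_diffeomorph_sphere_three_extends_ball →
    SphereEmbedding.schoenflies_exists_ball →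
    (cerf_diffeomorph_sphere_three_extends_ball → SphereEmbedding.schoenflies_exists_ball →
      FillingUniqueness) →
    (SphereEmbedding.schoenflies_exists_ball → HandlebodyExtension) →
    DehnNielsenBaerCentral →
    (FillingUniqueness → HandlebodyExtension → GeometricRigidity) →
    exists_stabilized_gkTrisection.{0} →
    ((∀ (k : ℕ) (K : TrisectionKernels (3 * k)),
        IsGroupTrisection (3 * k) k (PUnit : Type) K → K.IsStablyTrivial) →
      ∀ (M : Type) [TopologicalSpace M] [T2Space M] [SecondCountableTopology M],
        ContinuousMap.HomotopyEquiv.NonemptyDiffeomorphSphere M 4) :=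
  fun hΓ₄ hAlex hFU hHE hDNB hGR hc =>
    cruxBody_of_two_leaves
      (rigidity_of_geometricRigidity_of_dnb (hGR (hFU hΓ₄ hAlex) (hHE hAlex)) hDNB) hc

/-- **The skeleton theorem: the crux BY NAME from the seven registered stubs**
(`Summit.SmoothPoincare4.SmoothPoincare4.Theses.CongruenceShadows.AgkCor6Sufficiency`; `sorry`
occurs only inside the `stub_*` declarations it invokes; it closes when they are proved). -/
theorem AgkCor6Sufficiency_of : AgkCor6Sufficiency :=
  AgkCor6Sufficiency_of_stubStatements stub_gammaFour stub_alexander stub_fillingUniqueness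
    stub_handlebodyExtension stub_dehnNielsenBaer stub_geometricRigidity stub_stabilization

/-- **The same for the shared decl of route `GroupTrisection`** (identical body; this is the decl
`ledger skeleton check` resolves by default, the item's first `wanted_by`). -/
theorem AgkCor6Sufficiency_of' :
    Summit.SmoothPoincare4.SmoothPoincare4.Theses.GroupTrisection.AgkCor6Sufficiency :=
  AgkCor6Sufficiency_of_stubStatements stub_gammaFour stub_alexander stub_fillingUniqueness
    stub_handlebodyExtension stub_dehnNielsenBaer stub_geometricRigidity stub_stabilization

/-- **Alternative last step** (if the tree lands (d′) + one stabilisable marking (G) before the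
full (c′): `TrisectionStabilizationDatumAssemblyOne.lean`, Probe.lean of triage r1-1): the same
six (b′)-side stubs close the crux through `spc4_of_forall_isStablyTrivial_of_stabilizableMarking`
instead of `stub_stabilization` (stated on the body of the crux). -/
theorem cruxBody_of_stabilizableMarking
    (hΓ₄ : cerf_diffeomorph_sphere_three_extends_ball)
    (hAlex : SphereEmbedding.schoenflies_exists_ball)
    (hFU : cerf_diffeomorph_sphere_three_extends_ball → SphereEmbedding.schoenflies_exists_ball →
      FillingUniqueness)
    (hHE : SphereEmbedding.schoenflies_exists_ball → HandlebodyExtension)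
    (hDNB : DehnNielsenBaerCentral)
    (hGR : FillingUniqueness → HandlebodyExtension → GeometricRigidity)
    (hd : sphere_gkTrisections)
    (hG : ∀ (X : Type) [TopologicalSpace X] [T2Space X] [SecondCountableTopology X]
      [ChartedSpace (EuclideanSpace ℝ (Fin 4)) X] [IsManifold (𝓡 4) ∞ X] [CompactSpace X]
      [ConnectedSpace X] (_ : SmoothOrientation (𝓡 4) X) (g k : ℕ) (S : Fin 3 → Set X)
      (h : IsBalancedGKTrisection X g k S),
      ∃ (x₀ : centralSurface S) (μ : SurfaceGroup g ≃* FundamentalGroup (centralSurface S) x₀),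
        ∀ n : ℕ, ∃ (S' : Fin 3 → Set X) (h' : IsBalancedGKTrisection X (g + 3 * n) (k + n) S')
          (x₀' : centralSurface S')
          (μ' : SurfaceGroup (g + 3 * n) ≃* FundamentalGroup (centralSurface S') x₀'),
          groupGKTrisectionOf h' x₀' μ' = (groupGKTrisectionOf h x₀ μ).stabilizeIter n) :
    (∀ (k : ℕ) (K : TrisectionKernels (3 * k)),
        IsGroupTrisection (3 * k) k (PUnit : Type) K → K.IsStablyTrivial) →
      ∀ (M : Type) [TopologicalSpace M] [T2Space M] [SecondCountableTopology M],
        ContinuousMap.HomotopyEquiv.NonemptyDiffeomorphSphere M 4 :=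
  fun hst M _ _ _ =>
    spc4_of_forall_isStablyTrivial_of_stabilizableMarking exists_isBalancedGKTrisection_holds
      (rigidity_of_geometricRigidity_of_dnb (hGR (hFU hΓ₄ hAlex) (hHE hAlex)) hDNB) hd hG hst M

end Summit.SmoothPoincare4.SmoothPoincare4.Cruxes.AgkCor6Sufficiency.LpBySphereSystemSurgery

end
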